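import Summits.CriticalPhenomena.PercolationContinuityZ3.Theorems.PercNearOneGluingNoHeavyLowerTailSahiE3TwoPrimeSlot
import Summits.CriticalPhenomena.PercolationContinuityZ3.Theorems.PercNearOneGluingNoHeavyLowerTailSahiE3DeterminedMeetFKGCube
import Mathlib.Tactic.Linarith
import HarnessLib
import HarnessLib.Audit

/-!
# `NoHeavyLowerTail` (crux stmt-CriticalPhenomena-4575), Sahi programme P4: FKG slot-locality at two join-primes — the cube `ι → Bool`

Support file (cell `prim-l12`, seat P4, generation 6; `--supports stmt-CriticalPhenomena-4575`).  No named facts, no sorries; standard axioms.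

The slot-locality theorem `SahiE3TwoPrimeSlot.latticeE3_nonneg_of_supPrime_union` (Sahi's `C₃` for `(↑j₁ ∪ ↑j₂, A, B)`, every FKG weight on every
finite distributive lattice) specialised to the cube `ι → Bool` used by the cell's cube files (decidable pointwise order from `…SahiE3DeterminedMeetFKGCube`) (`…SahiC3CubeFourFKG*`, `…SahiE3DeterminedMeetFKGCube`):
the coordinate vectors `e_i = update ⊥ i true` are join-prime and `↑e_i ∪ ↑e_k = {x | x i ∨ x k}`, so

  `latticeE3_nonneg_cube_or : 0 ≤ latticeE3 μ {x | x i || x k} A B`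

for every nonnegative log-supermodular `μ` on `ι → Bool`, all up-sets `A, B` and all coordinates `i, k` (also in slots 2 and 3): Sahi's `C₃` for every FKG measure
in every dimension whenever one slot is the OR of two coordinates — for `|ι| = 5` this settles 295 of the 1 067 residual tri-saturated `S₅`-orbits of the
seat's atlas for every FKG weight (HOME prim-l12-p4/FROM-prim-l12-p4-gen6-FKG-SLOT-LOCALITY.md §REACH).
-/

namespace Summit.CriticalPhenomena.PercolationContinuityZ3.Theorems.SahiE3TwoPrimeSlot

open Finset Function Literature.Probability.LatticeModels

variable {ι : Type*} [Fintype ι] [DecidableEq ι]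

omit [Fintype ι] in
/-- `update ⊥ i true ≤ x ↔ x i = true`. [folklore] -/
theorem update_bot_le_iff (i : ι) (x : ι → Bool) : update (⊥ : ι → Bool) i true ≤ x ↔ x i = true := by
  rw [update_le_iff]
  constructor
  · rintro ⟨h, -⟩; exact top_le_iff.1 h
  · intro h; exact ⟨h ▸ le_rfl, fun j _ => bot_le⟩

omit [Fintype ι] in
/-- The coordinate vector `update ⊥ i true` is join-prime in the cube `ι → Bool`. [folklore] -/
theorem supPrime_update_bot (i : ι) : SupPrime (update (⊥ : ι → Bool) i true) := by
  refine ⟨fun h => ?_, fun x y hxy => ?_⟩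
  · have hle : update (⊥ : ι → Bool) i true ≤ ⊥ := h bot_le
    have := hle i
    rw [update_self] at this
    exact absurd this (by simp)
  · have hi : (x ⊔ y) i = true := by
      have := hxy i; rw [update_self] at this; exact top_le_iff.1 this
    rw [Pi.sup_apply] at hi
    have hle : ∀ z : ι → Bool, z i = true → update (⊥ : ι → Bool) i true ≤ z := fun z hz =>
      update_le_iff.2 ⟨hz ▸ le_rfl, fun j _ => bot_le⟩
    cases hx : x i
    · cases hy : y i
      · rw [hx, hy] at hi; exact absurd hi (by simp)
      · exact Or.inr (hle y hy)
    · exact Or.inl (hle x hx)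

/-- `↑e_i ∪ ↑e_k = {x | x i || x k}`. [this work] -/
theorem principalUp_update_union (i k : ι) :
    principalUp (update (⊥ : ι → Bool) i true) ∪ principalUp (update (⊥ : ι → Bool) k true) =
      univ.filter fun x : ι → Bool => (x i || x k) = true := by
  ext x
  rw [Finset.mem_union, mem_principalUp, mem_principalUp, update_bot_le_iff, update_bot_le_iff, Finset.mem_filter, Bool.or_eq_true]
  simp

/-- **Sahi's `C₃` on the cube `ι → Bool` for every FKG weight when one slot is `{x | x i ∨ x k}`** (the other two slots arbitrary up-sets,
any dimension). [this work] -/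
theorem latticeE3_nonneg_cube_or {μ : (ι → Bool) → ℝ} (hμ₀ : 0 ≤ μ) (hμ : ∀ a b, μ a * μ b ≤ μ (a ⊓ b) * μ (a ⊔ b)) (i k : ι)
    {A B : Finset (ι → Bool)} (hA : IsUpperSet (A : Set (ι → Bool))) (hB : IsUpperSet (B : Set (ι → Bool))) :
    0 ≤ latticeE3 μ (univ.filter fun x : ι → Bool => (x i || x k) = true) A B := by
  rw [← principalUp_update_union]
  exact latticeE3_nonneg_of_supPrime_union hμ₀ hμ (supPrime_update_bot i) (supPrime_update_bot k) hA hB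

/-- The same with the OR-slot in second position. [this work] -/
theorem latticeE3_nonneg_cube_or₂ {μ : (ι → Bool) → ℝ} (hμ₀ : 0 ≤ μ) (hμ : ∀ a b, μ a * μ b ≤ μ (a ⊓ b) * μ (a ⊔ b)) (i k : ι)
    {A B : Finset (ι → Bool)} (hA : IsUpperSet (A : Set (ι → Bool))) (hB : IsUpperSet (B : Set (ι → Bool))) :
    0 ≤ latticeE3 μ A (univ.filter fun x : ι → Bool => (x i || x k) = true) B := by
  rw [← principalUp_update_union]
  exact latticeE3_nonneg_of_supPrime_union₂ hμ₀ hμ (supPrime_update_bot i) (supPrime_update_bot k) hA hB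

/-- The same with the OR-slot in third position. [this work] -/
theorem latticeE3_nonneg_cube_or₃ {μ : (ι → Bool) → ℝ} (hμ₀ : 0 ≤ μ) (hμ : ∀ a b, μ a * μ b ≤ μ (a ⊓ b) * μ (a ⊔ b)) (i k : ι)
    {A B : Finset (ι → Bool)} (hA : IsUpperSet (A : Set (ι → Bool))) (hB : IsUpperSet (B : Set (ι → Bool))) :
    0 ≤ latticeE3 μ A B (univ.filter fun x : ι → Bool => (x i || x k) = true) := by
  rw [← principalUp_update_union]
  exact latticeE3_nonneg_of_supPrime_union₃ hμ₀ hμ (supPrime_update_bot i) (supPrime_update_bot k) hA hB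

end Summit.CriticalPhenomena.PercolationContinuityZ3.Theorems.SahiE3TwoPrimeSlot
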